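import Summits.NavierStokesRegularity.NavierStokesRegularity.Theorems.SelfMixingDichotomyMixingPayoffAdvectionDiffusionSchwartz
import Summits.NavierStokesRegularity.NavierStokesRegularity.Theorems.SelfMixingDichotomyCoherentScaleExclusionRadialBump
import Summits.NavierStokesRegularity.NavierStokesRegularity.Theorems.SelfMixingDichotomyCoherentScaleExclusionReflectionTangential
import Summits.NavierStokesRegularity.NavierStokesRegularity.Theorems.SelfMixingDichotomyCoherentScaleExclusionHeatIsometry
import Summits.NavierStokesRegularity.NavierStokesRegularity.Theorems.SelfMixingDichotomyCoherentScaleExclusionHeatUniqueness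
import Summits.NavierStokesRegularity.NavierStokesRegularity.Theorems.SelfMixingDichotomyCoherentScaleExclusionHeatBumpFloor
import Literature.Analysis.FluidPDE.DissipatesAtScale
import HarnessLib

/-!
# Route SelfMixingDichotomy — crux `CoherentScaleExclusion` (S2, stmt-NavierStokesRegularity-1423), line `registered`,
# lead c3: sphere-tangential drifts are coherent at EVERY scale (amplitude-free `¬ MIX`)

Support file (`--supports stmt-NavierStokesRegularity-1423`; registered sub-goal
`stub_sphereTangential_notDissipatesAtScale` of `Cruxes/CoherentScaleExclusion/Lines/birth.lean`).

Write `MIX(u, T, x₀, r, δ) = DissipatesAtScale u T x₀ r δ`: every smooth, uniformly rapidly decaying scalar `θ`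
solving `∂ₜθ + ⟪u, ∇θ⟫ = Δθ` on the window `S = [T − r², T − r²/2]` from a datum supported in `B(x₀, r)` keeps
at most the fraction `δ` of its `L²` norm. The crux S2 asks that recurrent NON-`δ`-mixing loaded scales at a
final-time point of a Navier–Stokes solution be impossible at a singularity. The only mechanism for `¬ MIX` in the
tree so far was a SIZE bound on the drift (the Type-I floor `stub_typeICoherence` /
`kinWitness_typeICoherence_of_windowBounds`: `√(T−t)‖u‖ ≤ K` forces `¬ MIX(r, δ)` for small `r` and
`δ ≤ δ₁(K)`, with `δ₁(K) → 0` as `K → ∞`).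

THIS FILE gives the amplitude-free mechanism behind the card's "coherent eddy" picture (CKRZ: a flow is not
relaxation-enhancing iff `u·∇` has `H¹` first integrals): if on the window the drift is TANGENTIAL TO THE SPHERES
about the centre, `⟪u(t,x), x⟫ = 0` — every pure swirl `a(t,x) • (−x₁, x₀, 0)`, every differential rotation or
spherical-shell flow, of ANY amplitude, shear and time dependence, with NO regularity assumption — then
`¬ MIX(u, T, 0, r, δ)` at EVERY scale `r > 0` for every `0 ≤ δ ≤ δ₁`, `δ₁ > 0` universal (a third of the
pure-heat bump floor). Proof: the radial bump `θ₀` (`stub_radialBump`) is launched by the heat equation on the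
window (W2 `stub_advectionDiffusionSchwartz` with the zero drift); for the reflection `R` in the plane `(ℝ v)ᗮ`,
`v = u(t,x)`, the function `θ ∘ R` is again an admissible heat solution (`stub_heatSolution_comp_linearIsometryEquiv`)
with the same radial datum, hence equals `θ` (`stub_heatSolution_unique`); as `x` lies in the mirror
(`⟪v, x⟫ = 0`), `⟪v, ∇θ(t,x)⟫ = 0` (`stub_inner_gradient_eq_zero_of_reflectionInvariant`) — the transport term
vanishes identically, `θ` is MIX-admissible for `u`, and `MIX(r, δ)` would give `∫θ(T−r²/2)² ≤ δ² ∫θ₀²`, against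
the heat floor `c² ∫θ₀² < ∫θ(T−r²/2)²` (`stub_heatBumpFloor_allScales`), once `δ ≤ c`.

Consequences (separate files): the regime-A stub of the crux is kinematically false for a FIXED `δ` and unbounded
thresholds `M` (self-similar swirling eddies of arbitrary amplitude stay `δ₁`-coherent), and the c2 witness against
regime B no longer needs its Type-I bound for coherence.
-/

noncomputable section

open Literature.Analysis.FluidPDE MeasureTheory Set Function Metric
open scoped ContDiff InnerProductSpace

-- `Summit = Problem` for this summit; the tree lakefile sets `weak.linter.dupNamespace = false`.
set_option linter.dupNamespace false

namespace Summit.NavierStokesRegularity.NavierStokesRegularity.Theorems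

/-- **SW0 — sphere-tangential drifts are coherent at every scale** (registered sub-goal
`stub_sphereTangential_notDissipatesAtScale`, lead c3). There is a universal `δ₁ > 0` such that for every drift
`u : ℝ → ℝ³ → ℝ³` tangential to the spheres about the origin on the window `[T − r², T − r²/2]`
(`⟪u(t,x), x⟫ = 0`; no size, regularity or time-dependence assumption), every `T`, every `r > 0` and every
`0 ≤ δ ≤ δ₁`: `¬ DissipatesAtScale u T 0 r δ`. The witness scalar is the HEAT evolution of a radial bump, which
is radial (isometry invariance + uniqueness) and therefore not transported by `u` at all. -/
theorem stub_sphereTangential_notDissipatesAtScale :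
    ∃ δ₁ : ℝ, 0 < δ₁ ∧
      ∀ (u : ℝ → EuclideanSpace ℝ (Fin 3) → EuclideanSpace ℝ (Fin 3)) (T r : ℝ), 0 < r →
      (∀ t ∈ Set.Icc (T - r ^ 2) (T - r ^ 2 / 2), ∀ x : EuclideanSpace ℝ (Fin 3),
        inner ℝ (u t x) x = 0) →
      ∀ δ : ℝ, 0 ≤ δ → δ ≤ δ₁ → ¬ DissipatesAtScale u T 0 r δ := by
  obtain ⟨c, hc, hHF⟩ := stub_heatBumpFloor_allScales
  refine ⟨c, hc, ?_⟩
  intro u T r hr htan δ hδ0 hδc hmix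
  have hr2 : 0 < r ^ 2 := by positivity
  have hab : T - r ^ 2 < T - r ^ 2 / 2 := by linarith
  -- the radial bump datum
  obtain ⟨θ₀, hθ₀s, hθ₀c, hθ₀0, hθ₀1, hone, hsupp, hrad⟩ := stub_radialBump r hr
  -- the admissible HEAT solution from `θ₀` on the window (W2 with the zero drift)
  have hv : IsSmoothSpaceTimeOn (Set.Icc (T - r ^ 2) (T - r ^ 2 / 2))
      (fun (_ : ℝ) (_ : EuclideanSpace ℝ (Fin 3)) => (0 : EuclideanSpace ℝ (Fin 3))) :=
    contDiffOn_const
  have hvb : ∀ n : ℕ, ∃ C : ℝ, ∀ t ∈ Set.Icc (T - r ^ 2) (T - r ^ 2 / 2), ∀ x : EuclideanSpace ℝ (Fin 3),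
      ‖iteratedFDerivWithin ℝ n (Function.uncurry
        (fun (_ : ℝ) (_ : EuclideanSpace ℝ (Fin 3)) => (0 : EuclideanSpace ℝ (Fin 3))))
        (Set.Icc (T - r ^ 2) (T - r ^ 2 / 2) ×ˢ Set.univ) (t, x)‖ ≤ C := by
    intro n
    refine ⟨0, fun t _ x => ?_⟩
    have h0 : Function.uncurry (fun (_ : ℝ) (_ : EuclideanSpace ℝ (Fin 3)) =>
        (0 : EuclideanSpace ℝ (Fin 3))) = fun _ => 0 := by
      funext p; rfl
    rw [h0, iteratedFDerivWithin_fun_zero]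
    simp
  obtain ⟨θ, hsm, hdec, hpde0, hθa⟩ :=
    stub_advectionDiffusionSchwartz (T - r ^ 2) (T - r ^ 2 / 2) hab _ hv hvb θ₀ hθ₀s hθ₀c
  -- the heat equation in pure form
  have hheat : ∀ t ∈ Set.Icc (T - r ^ 2) (T - r ^ 2 / 2), ∀ x : EuclideanSpace ℝ (Fin 3),
      timeDerivWithin (Set.Icc (T - r ^ 2) (T - r ^ 2 / 2)) θ t x = Laplacian.laplacian (θ t) x := by
    intro t ht x
    have h := hpde0 t ht x
    rwa [inner_zero_left, add_zero] at h
  -- KEY: the tangential drift does not see `θ`: `⟪u, ∇θ⟫ = 0`, so `θ` solves the advected equation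
  have hpdeu : ∀ t ∈ Set.Icc (T - r ^ 2) (T - r ^ 2 / 2), ∀ x : EuclideanSpace ℝ (Fin 3),
      timeDerivWithin (Set.Icc (T - r ^ 2) (T - r ^ 2 / 2)) θ t x + inner ℝ (u t x) (gradient (θ t) x)
        = Laplacian.laplacian (θ t) x := by
    intro t ht x
    have key : inner ℝ (u t x) (gradient (θ t) x) = 0 := by
      set R : EuclideanSpace ℝ (Fin 3) ≃ₗᵢ[ℝ] EuclideanSpace ℝ (Fin 3) :=
        (Submodule.span ℝ {u t x})ᗮ.reflection with hR
      -- `θ ∘ R⁻¹` is an admissible heat solution with the same (radial) datum, hence equals `θ`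
      obtain ⟨hsm', hdec', hheat'⟩ :=
        stub_heatSolution_comp_linearIsometryEquiv (T - r ^ 2) (T - r ^ 2 / 2) hab R θ hsm hdec hheat
      have hdat : (fun x => θ (T - r ^ 2) (R.symm x)) = θ (T - r ^ 2) := by
        funext y
        rw [hθa]
        exact hrad _ _ (by rw [LinearIsometryEquiv.norm_map])
      have huniq := stub_heatSolution_unique (T - r ^ 2) (T - r ^ 2 / 2) hab
        (fun t x => θ t (R.symm x)) θ hsm' hdec' hheat' hsm hdec hheat hdat t ht
      refine stub_inner_gradient_eq_zero_of_reflectionInvariant (θ t) (u t x) x ?_ ?_ (htan t ht x)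
      · exact (hsm.hasFDerivAt_slice ht x).differentiableAt
      · intro y
        have h1 := huniq y
        have h2 : R.symm = R := Submodule.reflection_symm
        rw [h2] at h1
        simpa [hR] using h1
    rw [key, add_zero]
    exact hheat t ht x
  -- `MIX(r, δ)` applied to `θ`
  have hsuppθ : Function.support (θ (T - r ^ 2)) ⊆ Metric.ball (0 : EuclideanSpace ℝ (Fin 3)) r := by
    rw [hθa]; exact hsupp
  have hM : ∫ x, (θ (T - r ^ 2 / 2) x) ^ 2 ≤ δ ^ 2 * ∫ x, (θ (T - r ^ 2) x) ^ 2 :=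
    hmix θ hsm hdec hpdeu hsuppθ
  -- the heat floor
  have hL : c ^ 2 * ∫ x, (θ (T - r ^ 2) x) ^ 2 < ∫ x, (θ (T - r ^ 2 / 2) x) ^ 2 :=
    hHF T r 0 hr θ hsm hdec hheat
      (fun x => by rw [hθa]; exact hθ₀0 x)
      (fun x => by rw [hθa]; exact hθ₀1 x)
      (fun x hx => by rw [hθa]; exact hone x hx)
      hsuppθ
  have hX : 0 ≤ ∫ x, (θ (T - r ^ 2) x) ^ 2 := integral_nonneg fun _ => sq_nonneg _
  have hδc2 : δ ^ 2 ≤ c ^ 2 := pow_le_pow_left₀ hδ0 hδc 2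
  exact lt_irrefl _ (hL.trans_le (hM.trans (mul_le_mul_of_nonneg_right hδc2 hX)))

end Summit.NavierStokesRegularity.NavierStokesRegularity.Theorems

end
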